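import Summits.HodgeConjecture.HodgeConjecture.Theorems.Ring2AbelianAllAndreWeightTheta
import Summits.HodgeConjecture.HodgeConjecture.Theorems.Ring2AbelianAllAndrePrimitiveProjectorAlgebraic
import HarnessLib

/-!
# Ring 2 · sub-cell AbelianAll (ALL ABELIAN VARIETIES), André axis, part XXVII-a — THE WEIGHT HYPOTHESIS IS ONE ALGEBRAIC IDEMPOTENT:
# the Leray package (wt), (wt₃), (top) of parts XXIV–XXVI enters the André axis only through ONE algebraic self-correspondence `e` of
# the total space per degree with `j_t^* ∘ e = j_t^*` and `e|_{ker j_t^*} = 0` (an algebraic LERAY IDEMPOTENT); every row re-proved for it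

HONEST FRAMING (page 1, verbatim): **research route, not a corollary; conditional on HC_CM plus one named
minimal statement.** Cell line: research route conditional on HC_CM; not a corollary; Q11.4-sentence-2
already refuted in dim ≥ 3. Nothing in this file proves a case of the Hodge conjecture for an abelian variety; `HC_CM` does not occur in this
file; item `Theses.RankFourFaces.CMToAbelian` (stmt-16267) OPEN and not closed here. Seat `pub-hodge-ring2-ab-andre-2`, gen 19; brief (ii)
"minimise: … replace B by algebraicity of specific Künneth/Lefschetz components and re-prove — record each version".

## What the weights were used for (parts XXIV-a/b/d, XXV, XXVI)

On a compact pencil `f : 𝒳 ⟶ S` of abelian `d`-folds with a point `t`, write `r = j_t^* : Hᵏ(𝒳) → Hᵏ(X_t)`. The displayed hypothesis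
(θ∀) `PencilTheta[]` (the abelian-scheme endomorphism `θ_N`) was turned into the Leray weights (wt), (wt₃), (top) of an endomorphism `ν`,
and these were used for exactly one thing: the Lagrange polynomial `e_ν = (ν^* − N^{k-1})(ν^* − N^{k-2}) / ((Nᵏ − N^{k-1})(Nᵏ − N^{k-2}))`
is an endomorphism of `Hᵏ(𝒳)` which (Π1) is an algebraic correspondence, (Π2) preserves rational classes, (π) satisfies `r ∘ e = r`, and (κ) kills `ker r`. THIS FILE
takes such an `e` — an **algebraic Leray idempotent at `t` in degree `k`** — as the datum and re-proves every theorem of parts XXIV-a §1,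
XXIV-b §4 and XXIV-d §8–§9 from (Π1), (Π2), (π), (κ) alone.

## What is proved (theorems only; no definition, no named fact, no sorry; `HC_CM` absent)

§1 **Algebraic self-correspondences of degree `0` respect Hodge types**: `IsAlgebraicCorrespondence.isOfHodgeType_endo` (an
`IsAlgebraicCorrespondence n n X X T`, `T : Hᵏ → Hᵏ`, maps `H^{p,q}` to `H^{p,q}` — normalisation to the complex orientations, part
XXII-e, then pull-back / cup with the `(n,n)`-class / Gysin shift `(−n,−n)`, Voisin I §7.3.2), `IsAlgebraicCorrespondence.typeProj_comm`
(hence commutes with the Hodge-type projectors of any Hodge model).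
§2 **The idempotent**: from (π) and (κ) alone — `e ∘ e = e` (`leray_idempotent`), `e w = 0 ↔ r w = 0`, two `e`-fixed classes with the
same restriction to `X_t` are equal (`fixed_eq_of_map_fiberι_eq`, the analogue of (top)), and **`Hᵏ(𝒳) = Im e ⊕ ker j_t^*`**
(`isCompl_range_ker_of_leray`).
§3 **Canonical lifts**: (Π1) every algebraic class has an algebraic `e`-fixed companion with the same restriction (`exists_fixed_lift`);
(Π2) a rational class has a rational one (`exists_fixed_lift_rational`); an `e`-fixed class reads its Hodge type (`isOfHodgeType_of_fixed`,
§1 + (κ)) and its rationality (`isRationalClass_of_fixed`, part XVII-a + (Π2)) on the fibre `X_t`.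
§4 **(L)_t(p) ⟺ [the `e`-fixed classes with algebraic restriction are algebraic]** (`comap_le_sup_iff_forall_fixed_mem`) **⟺ [the
rational `(p,p)`-classes fixed by `e` are algebraic]** at a fibre whose rational `(p,p)`-classes are algebraic
(`comap_le_sup_iff_forall_fixed_hodge_mem`; ⟸ needs no fibre hypothesis) — THE HODGE CONJECTURE FOR `Im e`. And the reading does not
depend on the idempotent: for two data `e, e'` at `(t, 2p)` the two Hodge statements are equivalent (`forall_fixed_hodge_mem_iff_of_two`).
Suppliers — (a) the weight package (wt), (wt₃), (top) of an endomorphism `ν` IS one such idempotent (the Lagrange polynomial in `ν^*`,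
with `e y = y ↔ ν^* y = Nᵏ y`), (b) a clause of the fibre-class Lefschetz node (β′_f) gives `e = T ∘ L_t` — are part XXVII-b
(`Ring2AbelianAllAndreLerayIdempotentSuppliers`); the node level (display-only brackets `CMLerayIdempotent[]`, `CMIdempotentHodge[]`,
edges from `CMWeights[]` / `PencilTheta[]`, rows) is part XXVII-c (`Ring2AbelianAllAndreLerayIdempotentNodes`).

## Honest status

No node is born; nothing is minimal; nothing here is fact-free progress on `HC_AV`. WHAT IS GAINED: the WEAKEST FORM ACTUALLY USED of the
André-axis weight hypothesis is now typed — per (pencil, CM point `t`, degree `2p ≤ 2d`): ONE algebraic cycle class on `𝒳 × 𝒳` with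
rational coefficients acting on `H^{2p}(𝒳)` as an idempotent with kernel `ker j_t^*` (in print: the Leray / relative Künneth projector onto
`H⁰(S, R^{2p} f_*ℚ) ⊂ H^{2p}(𝒳)`, algebraic for abelian schemes by the `θ_n`-Vandermonde formula of Deninger–Murre Thm. 3.1 / Künnemann;
for an arbitrary smooth projective family it is a case of the standard conjectures). It is implied by (θ∀) (through the weights, (a)) and,
up to `ℚ`-normalisation, by (β′) ((b)); by parts XVI-c/d every such cycle has a component dominating `S × S` (it is not supported over a
curve of `S × S`: those correspondences preserve `ker j_t^*` AND `Im j_{t*}` and induce on `H/ker j_t^*` only what the fibre sees).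

References: Milne2020HodgeClassesAV (proof of Prop. 1, pp. 7–8); DeningerMurre1991 (Thm. 3.1, Cor. 3.2); Kleiman1968AlgebraicCycles (p. 374);
VoisinHodgeI2002 (§7.1.1, §7.3.2, Lemma 11.41); VoisinHodgeII2003 ((10.7), Prop. 9.20); Andre1996Motifs (§2.1, §5.1, Remarque 2); MumfordGIT (Thm. 6.14).
-/

noncomputable section

set_option linter.dupNamespace false

namespace Summit.HodgeConjecture.HodgeConjecture.Ring2.AbelianAll

open CategoryTheory AlgebraicGeometry MonoidalCategory CartesianMonoidalCategory
open Literature.AlgebraicGeometry Literature.AlgebraicGeometry.Motives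
open Literature.AlgebraicGeometry.HodgeTheory
open Literature.AlgebraicTopology.SingularHomology (singularCohomology cupProduct)

/-! ## §1 Algebraic self-correspondences of degree `0` respect Hodge types -/

section HodgeTypes

variable {n : ℕ} {X : SchemeOver ℂ}

/-- **An algebraic self-correspondence `T : Hᵏ(X(ℂ)) → Hᵏ(X(ℂ))` maps `H^{p,q}` to `H^{p,q}`.** Normalise `T = γ_*` to the complex
orientations with `γ ∈ Nⁿ H²ⁿ((X ⊗ X)(ℂ))` (part XXII-e; the codimension is forced to be `n = dim X`); `pr₂^* c` is of type `(p,q)`,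
`γ` of type `(n,n)` (algebraic classes are of type `(n,n)`, a tree theorem), the cup product of type `(p+n, q+n)` (de Rham's theorem in
multiplicative form, a tree theorem) and `pr_{1*}` shifts types by `(−n,−n)`. [cite: VoisinHodgeI2002, §7.3.2 (with Lemma 7.30) and §11.3.3 Lemma 11.41]
[cite: Andre1996Motifs, §2.1 (p. 14)] -/
theorem IsAlgebraicCorrespondence.isOfHodgeType_endo (hX : IsSmoothProjective n X) {k : ℕ}
    {T : complexBetti X k →ₗ[ℂ] complexBetti X k} (hT : IsAlgebraicCorrespondence n n X X T) {p q : ℕ}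
    {c : complexBetti X k} (hc : IsOfHodgeType n X k p q c) : IsOfHodgeType n X k p q (T c) := by
  obtain ⟨e, hab, γ, hγ, rfl⟩ := IsAlgebraicCorrespondence.exists_eq_corrAction hX hX hT
  obtain rfl : n = e := by omega
  have hI := hodgePQ_independent_of_hodgeModel_holds
  have hXX : IsSmoothProjective (n + n) (X ⊗ X) := IsSmoothProjective.tensor_holds hX hX
  have h2 : IsOfHodgeType (n + n) (X ⊗ X) k p q (complexBetti.map (snd X X) k c) :=
    hc.map_of_isSmoothProjective hXX hX (snd X X)
  have h3 : IsOfHodgeType (n + n) (X ⊗ X) (2 * n) n n γ :=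
    isOfHodgeType_of_mem_algebraicClasses_of_isSmoothProjective hXX n hγ
  have hcup : CupPreservesHodgeType (n + n) (X ⊗ X) :=
    cupPreservesHodgeType_of_multiplicative_deRham
      (fun E _ _ _ ↦ Literature.NumberTheory.Transcendental.exists_deRhamIsoFamily_holds (E := E)) hXX
  have h4 : IsOfHodgeType (n + n) (X ⊗ X) (k + 2 * n) (p + n) (q + n)
      (cupProduct (rfl : k + 2 * n = k + 2 * n) (complexBetti.map (snd X X) k c) γ) :=
    hcup rfl h2 h3
  rw [corrAction_apply]
  exact isOfHodgeType_complexGysin hI (fun _ _ ↦ nonempty_hodgeModel_holds)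
    (fun E _ _ _ ↦ Literature.NumberTheory.Transcendental.exists_deRhamIsoFamily_holds (E := E))
    complexOrientationFamily hXX hX (fst X X) (corrAction_degree n hab) (p := p + n) (q := q + n) (p' := p) (q' := q)
    (by omega) (by omega) h4

/-- **An algebraic self-correspondence of degree `0` commutes with the Hodge-type projectors** of every Hodge model `A` of `X`:
`π^A_{(p,q)}(T c) = T(π^A_{(p,q)} c)` (`T c = ∑ T(π_{(p,q)} c)` is a decomposition into classes of the respective types by the previous
theorem, and the type decomposition is unique, Voisin I Thm. 6.18). [cite: VoisinHodgeI2002, Thm. 6.18 and §7.3.2] -/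
theorem IsAlgebraicCorrespondence.typeProj_comm (hX : IsSmoothProjective n X) (A : HodgeModel n X) {k : ℕ}
    {T : complexBetti X k →ₗ[ℂ] complexBetti X k} (hT : IsAlgebraicCorrespondence n n X X T)
    (pq : ↥(Finset.HasAntidiagonal.antidiagonal k)) (c : complexBetti X k) :
    A.typeProj k pq (T c) = T (A.typeProj k pq c) := by
  refine A.typeProj_eq_of_sum_eq (y := fun pq' ↦ T (A.typeProj k pq' c)) ?_ ?_ pq
  · intro pq'
    exact A.mem_typePiece_of_isOfHodgeType hodgePQ_independent_of_hodgeModel_holds hX pq'.2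
      (IsAlgebraicCorrespondence.isOfHodgeType_endo hX hT (A.isOfHodgeType_of_mem_typePiece (A.typeProj_mem k pq' c)))
  · rw [← map_sum, A.sum_typeProj]

end HodgeTypes

/-! ## §2 The idempotent: `e ∘ e = e`, `ker e = ker j_t^*`, `Hᵏ(𝒳) = Im e ⊕ ker j_t^*` — from (π) and (κ) alone -/

section Idempotent

variable {𝒳 S : SchemeOver ℂ} {f : 𝒳 ⟶ S} {k : ℕ}

/-- **(π) ∧ (κ) ⟹ `e` is idempotent**: `e(e w) − e w = e(e w − w)` and `e w − w` dies on `X_t`. [cite: Milne2020HodgeClassesAV, proof of Prop. 1 (p. 7)]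
[cite: DeningerMurre1991, Thm. 3.1] -/
theorem leray_idempotent (t : ComplexPoints S) (e : complexBetti 𝒳 k →ₗ[ℂ] complexBetti 𝒳 k)
    (hπ : ∀ w, complexBetti.map (fiberι f t) k (e w) = complexBetti.map (fiberι f t) k w)
    (hκ : ∀ w, complexBetti.map (fiberι f t) k w = 0 → e w = 0) (w : complexBetti 𝒳 k) : e (e w) = e w := by
  rw [← sub_eq_zero, ← map_sub]
  exact hκ _ (by rw [map_sub, hπ, sub_self])

/-- **`ker e = ker j_t^*`** ((π): `j_t^* w = j_t^*(e w)`; (κ) is the converse). [cite: Milne2020HodgeClassesAV, proof of Prop. 1 (p. 7)] -/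
theorem leray_eq_zero_iff (t : ComplexPoints S) (e : complexBetti 𝒳 k →ₗ[ℂ] complexBetti 𝒳 k)
    (hπ : ∀ w, complexBetti.map (fiberι f t) k (e w) = complexBetti.map (fiberι f t) k w)
    (hκ : ∀ w, complexBetti.map (fiberι f t) k w = 0 → e w = 0) (w : complexBetti 𝒳 k) :
    e w = 0 ↔ complexBetti.map (fiberι f t) k w = 0 := ⟨fun h ↦ by rw [← hπ, h, map_zero], hκ w⟩

/-- **THE `e`-FIXED LIFT IS CANONICAL** (the analogue of (top)): two `e`-fixed classes with the same restriction to `X_t` are equal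
(`y − y' = e(y − y')` dies on `X_t`). [cite: Milne2020HodgeClassesAV, proof of Prop. 1 (p. 7)] [cite: VoisinHodgeII2003, §4.3.1 Thm. 4.18] -/
theorem fixed_eq_of_map_fiberι_eq (t : ComplexPoints S) (e : complexBetti 𝒳 k →ₗ[ℂ] complexBetti 𝒳 k)
    (hκ : ∀ w, complexBetti.map (fiberι f t) k w = 0 → e w = 0) {y y' : complexBetti 𝒳 k} (hy : e y = y) (hy' : e y' = y')
    (heq : complexBetti.map (fiberι f t) k y = complexBetti.map (fiberι f t) k y') : y = y' := by
  rw [← sub_eq_zero, ← hy, ← hy', ← map_sub]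
  exact hκ _ (by rw [map_sub, heq, sub_self])

/-- An `e`-fixed class vanishing on `X_t` is zero ((top) for the idempotent). [cite: Milne2020HodgeClassesAV, proof of Prop. 1 (p. 7)] -/
theorem fixed_eq_zero_of_map_fiberι_eq_zero (t : ComplexPoints S) (e : complexBetti 𝒳 k →ₗ[ℂ] complexBetti 𝒳 k)
    (hκ : ∀ w, complexBetti.map (fiberι f t) k w = 0 → e w = 0) {y : complexBetti 𝒳 k} (hy : e y = y)
    (h0 : complexBetti.map (fiberι f t) k y = 0) : y = 0 :=
  hy ▸ hκ _ h0

/-- **`Hᵏ(𝒳(ℂ); ℂ) = Im e ⊕ ker j_t^*`**: the image of a Leray idempotent is a complement of the classes vanishing on the fibre (in print: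
`H⁰(S, Rᵏ f_*) ⊕ L¹Hᵏ(𝒳)`, the splitting of the first step of the Leray filtration). [cite: DeningerMurre1991, Thm. 3.1 and Cor. 3.2]
[cite: VoisinHodgeII2003, §4.3.1 Thm. 4.18] -/
theorem isCompl_range_ker_of_leray (t : ComplexPoints S) (e : complexBetti 𝒳 k →ₗ[ℂ] complexBetti 𝒳 k)
    (hπ : ∀ w, complexBetti.map (fiberι f t) k (e w) = complexBetti.map (fiberι f t) k w)
    (hκ : ∀ w, complexBetti.map (fiberι f t) k w = 0 → e w = 0) :
    IsCompl (LinearMap.range e) (LinearMap.ker (complexBetti.map (fiberι f t) k).hom) := by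
  refine ⟨Submodule.disjoint_def.2 fun x hx hx0 ↦ ?_, codisjoint_iff.2 (eq_top_iff.2 fun w _ ↦ ?_)⟩
  · obtain ⟨y, rfl⟩ := LinearMap.mem_range.1 hx
    rw [LinearMap.mem_ker] at hx0
    exact fixed_eq_zero_of_map_fiberι_eq_zero t e hκ (leray_idempotent t e hπ hκ y) hx0
  · rw [show w = e w + (w - e w) by abel]
    refine Submodule.add_mem_sup (LinearMap.mem_range_self e w) ?_
    rw [LinearMap.mem_ker]
    change complexBetti.map (fiberι f t) k (w - e w) = 0
    rw [map_sub, hπ, sub_self]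

end Idempotent

/-! ## §3 Canonical (`e`-fixed) lifts: algebraicity, rationality and Hodge type are read on the fibre -/

section Lifts

variable {𝒳 S : SchemeOver ℂ} {d : ℕ} {f : 𝒳 ⟶ S}

/-- **`e`-FIXED LIFTS OF ALGEBRAIC LIFTS ARE ALGEBRAIC** ((Π1), (π), (κ) in degree `2p`): every algebraic `y ∈ Nᵖ(𝒳)` has the algebraic
companion `e y ∈ Nᵖ(𝒳)`, fixed by `e`, with the same restriction to `X_t` (algebraic correspondences preserve algebraic classes, a tree
theorem). The analogue of part XXIV-a's `exists_topWeight_lift`. [cite: Milne2020HodgeClassesAV, proof of Prop. 1 (p. 7)]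
[cite: VoisinHodgeII2003, §9.2.4 Prop. 9.21] [cite: DeningerMurre1991, Thm. 3.1] -/
theorem exists_fixed_lift (hf : IsCompactAbelianPencil f d) (t : ComplexPoints S) {p : ℕ}
    (e : complexBetti 𝒳 (2 * p) →ₗ[ℂ] complexBetti 𝒳 (2 * p)) (halg : IsAlgebraicCorrespondence (d + 1) (d + 1) 𝒳 𝒳 e)
    (hπ : ∀ w, complexBetti.map (fiberι f t) (2 * p) (e w) = complexBetti.map (fiberι f t) (2 * p) w)
    (hκ : ∀ w, complexBetti.map (fiberι f t) (2 * p) w = 0 → e w = 0)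
    {y : complexBetti 𝒳 (2 * p)} (hy : y ∈ algebraicClasses 𝒳 p) :
    ∃ y₀ ∈ algebraicClasses 𝒳 p, e y₀ = y₀ ∧
      complexBetti.map (fiberι f t) (2 * p) y₀ = complexBetti.map (fiberι f t) (2 * p) y :=
  ⟨e y, map_mem_algebraicClasses_of_isAlgebraicCorrespondence hf.isSmoothProjective_total hf.isSmoothProjective_total halg hy,
    leray_idempotent t e hπ hκ y, hπ y⟩

/-- **A RATIONAL class has a RATIONAL `e`-fixed companion with the same restriction** ((Π2), (π), (κ)). The analogue of part XXIV-d's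
`exists_topWeight_lift_rational`. [cite: VoisinHodgeI2002, §7.1.1] [cite: Milne2020HodgeClassesAV, proof of Prop. 1 (p. 7)] -/
theorem exists_fixed_lift_rational (t : ComplexPoints S) {k : ℕ} (e : complexBetti 𝒳 k →ₗ[ℂ] complexBetti 𝒳 k)
    (hQ : ∀ w, IsRationalClass w → IsRationalClass (e w))
    (hπ : ∀ w, complexBetti.map (fiberι f t) k (e w) = complexBetti.map (fiberι f t) k w)
    (hκ : ∀ w, complexBetti.map (fiberι f t) k w = 0 → e w = 0) {W : complexBetti 𝒳 k} (hW : IsRationalClass W) :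
    ∃ W₀ : complexBetti 𝒳 k, IsRationalClass W₀ ∧ e W₀ = W₀ ∧
      complexBetti.map (fiberι f t) k W₀ = complexBetti.map (fiberι f t) k W :=
  ⟨e W, hQ W hW, leray_idempotent t e hπ hκ W, hπ W⟩

/-- **AN `e`-FIXED CLASS READS ITS HODGE TYPE ON THE FIBRE** ((Π1), (κ)): if `e y₀ = y₀` and `j_t^* y₀` has Hodge type `(p,q)` on `X_t`
then `y₀` has type `(p,q)` on `𝒳` — in a Hodge model `A` of `𝒳` the other type components `π_{(p',q')} y₀` are again `e`-fixed (§1: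
`e` commutes with the type projectors) and die on `X_t` (part XVI-a `isOfHodgeType_map_iff_forall_typeProj`), hence vanish by (κ). Print:
`H⁰(S, Rᵏ f_*)` is a sub-Hodge structure of `Hᵏ(X_t)`. The analogue of part XXIV-d's `isOfHodgeType_of_topWeight`.
[cite: DeligneHodgeII1971, Cor. 4.1.2 and (4.1.3.1)] [cite: VoisinHodgeI2002, §7.1.1 and §7.3.2] -/
theorem isOfHodgeType_of_fixed (hf : IsCompactAbelianPencil f d) (t : ComplexPoints S) {k : ℕ}
    (e : complexBetti 𝒳 k →ₗ[ℂ] complexBetti 𝒳 k) (halg : IsAlgebraicCorrespondence (d + 1) (d + 1) 𝒳 𝒳 e)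
    (hκ : ∀ w, complexBetti.map (fiberι f t) k w = 0 → e w = 0) {p q : ℕ} (hpq : p + q = k)
    {y₀ : complexBetti 𝒳 k} (hy₀ : e y₀ = y₀) (hH : IsOfHodgeType d (fiberOver f t) k p q (complexBetti.map (fiberι f t) k y₀)) :
    IsOfHodgeType (d + 1) 𝒳 k p q y₀ := by
  have h𝒳 := hf.isSmoothProjective_total
  have hXt := hf.isSmoothProjective_fiberOver t
  obtain ⟨A⟩ := nonempty_hodgeModel_holds h𝒳
  have hmem : (p, q) ∈ Finset.HasAntidiagonal.antidiagonal k := Finset.HasAntidiagonal.mem_antidiagonal.2 hpq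
  have hcomp := (isOfHodgeType_map_iff_forall_typeProj h𝒳 hXt (fiberι f t) A hpq y₀).1 hH
  -- every other type component is `e`-fixed and dies on the fibre, hence vanishes
  have hzero : ∀ pq' : ↥(Finset.HasAntidiagonal.antidiagonal k), pq'.1 ≠ (p, q) → A.typeProj k pq' y₀ = 0 := by
    intro pq' hne
    refine fixed_eq_zero_of_map_fiberι_eq_zero t e hκ ?_ (hcomp pq' hne)
    rw [← IsAlgebraicCorrespondence.typeProj_comm h𝒳 A halg pq' y₀, hy₀]
  have hsum : y₀ = A.typeProj k ⟨(p, q), hmem⟩ y₀ := by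
    conv_lhs => rw [← A.sum_typeProj k y₀]
    rw [Finset.sum_eq_single ⟨(p, q), hmem⟩]
    · intro pq' _ hne
      exact hzero pq' fun heq ↦ hne (Subtype.ext heq)
    · intro habs
      exact absurd (Finset.mem_univ _) habs
  have h := A.isOfHodgeType_of_mem_typePiece (A.typeProj_mem k ⟨(p, q), hmem⟩ y₀)
  dsimp only at h
  rwa [← hsum] at h

/-- **AN `e`-FIXED CLASS READS ITS RATIONALITY ON THE FIBRE** ((Π2), (π), (κ)): if `j_t^* y₀` is rational then so is `y₀` — a rational
global class with the same fibre restriction exists (part XVII-a), its `e`-fixed companion is rational and equals `y₀` by uniqueness.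
The analogue of part XXIV-d's `isRationalClass_of_topWeight`. [cite: VoisinHodgeI2002, §7.1.1] [cite: HatcherAT2002, §3.1 Thm. 3.2] -/
theorem isRationalClass_of_fixed (hf : IsCompactAbelianPencil f d) (t : ComplexPoints S) {k : ℕ}
    (e : complexBetti 𝒳 k →ₗ[ℂ] complexBetti 𝒳 k) (hQ : ∀ w, IsRationalClass w → IsRationalClass (e w))
    (hπ : ∀ w, complexBetti.map (fiberι f t) k (e w) = complexBetti.map (fiberι f t) k w)
    (hκ : ∀ w, complexBetti.map (fiberι f t) k w = 0 → e w = 0) {y₀ : complexBetti 𝒳 k} (hy₀ : e y₀ = y₀)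
    (hQ' : IsRationalClass (complexBetti.map (fiberι f t) k y₀)) : IsRationalClass y₀ := by
  obtain ⟨W, hWQ, hWs⟩ := exists_isRationalClass_map_fiberι_eq hf y₀ hQ'
  obtain ⟨W₀, hW₀Q, hW₀e, hW₀j⟩ := exists_fixed_lift_rational t e hQ hπ hκ hWQ
  rw [fixed_eq_of_map_fiberι_eq t e hκ hy₀ hW₀e (by rw [hW₀j, hWs t])]
  exact hW₀Q

end Lifts

/-! ## §4 (L)_t(p) ⟺ the `e`-fixed lifts are algebraic ⟺ the Hodge conjecture for `Im e` -/

section Lift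

variable {𝒳 S : SchemeOver ℂ} {d : ℕ} {f : 𝒳 ⟶ S}

/-- **(L)_t(p) ⟺ [every `e`-FIXED class of `𝒳` whose restriction to `X_t` is algebraic IS algebraic]**, for an algebraic Leray idempotent
`e` at `t` in degree `2p` ((Π1), (π), (κ)). (⟹): an algebraic lift `y` of `j_t^* y₀` has the algebraic `e`-fixed companion `e y`, equal
to `y₀` by uniqueness; (⟸): `W = e W + (W − e W)` with `e W` algebraic and `W − e W ∈ ker j_t^*`. The analogue of part XXIV-b's
`comap_le_sup_iff_forall_topWeight_mem`. [cite: Milne2020HodgeClassesAV, proof of Prop. 1 (pp. 7–8)] [cite: Andre1996Motifs, §5.1 (p. 25)] -/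
theorem comap_le_sup_iff_forall_fixed_mem (hf : IsCompactAbelianPencil f d) (t : ComplexPoints S) {p : ℕ}
    (e : complexBetti 𝒳 (2 * p) →ₗ[ℂ] complexBetti 𝒳 (2 * p)) (halg : IsAlgebraicCorrespondence (d + 1) (d + 1) 𝒳 𝒳 e)
    (hπ : ∀ w, complexBetti.map (fiberι f t) (2 * p) (e w) = complexBetti.map (fiberι f t) (2 * p) w)
    (hκ : ∀ w, complexBetti.map (fiberι f t) (2 * p) w = 0 → e w = 0) :
    (algebraicClasses (fiberOver f t) p).comap (complexBetti.map (fiberι f t) (2 * p)).hom ≤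
        algebraicClasses 𝒳 p ⊔ LinearMap.ker (complexBetti.map (fiberι f t) (2 * p)).hom ↔
      ∀ y₀ : complexBetti 𝒳 (2 * p), e y₀ = y₀ →
        complexBetti.map (fiberι f t) (2 * p) y₀ ∈ algebraicClasses (fiberOver f t) p → y₀ ∈ algebraicClasses 𝒳 p := by
  refine ⟨fun hL y₀ hy₀ halg' ↦ ?_, fun h W hW ↦ ?_⟩
  · have hcomap : y₀ ∈ (algebraicClasses (fiberOver f t) p).comap (complexBetti.map (fiberι f t) (2 * p)).hom := halg'
    obtain ⟨y, hy, z, hz, hyz⟩ := Submodule.mem_sup.1 (hL hcomap)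
    rw [LinearMap.mem_ker] at hz
    have hyy₀ : complexBetti.map (fiberι f t) (2 * p) y = complexBetti.map (fiberι f t) (2 * p) y₀ := by
      conv_rhs => rw [← hyz, map_add, hz, add_zero]
    obtain ⟨y₀', hy₀'alg, hy₀'e, hy₀'y⟩ := exists_fixed_lift hf t e halg hπ hκ hy
    rw [fixed_eq_of_map_fiberι_eq t e hκ hy₀ hy₀'e (by rw [hy₀'y, hyy₀])]
    exact hy₀'alg
  · have hW' : complexBetti.map (fiberι f t) (2 * p) W ∈ algebraicClasses (fiberOver f t) p := hW
    have hW₀ : e W ∈ algebraicClasses 𝒳 p := h (e W) (leray_idempotent t e hπ hκ W) (by rw [hπ]; exact hW')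
    rw [show W = e W + (W - e W) by abel]
    refine Submodule.add_mem_sup hW₀ ?_
    rw [LinearMap.mem_ker]
    change complexBetti.map (fiberι f t) (2 * p) (W - e W) = 0
    rw [map_sub, hπ, sub_self]

/-- **[every `e`-fixed RATIONAL `(p,p)`-class of `𝒳` is algebraic] ⟹ (L)_t(p)** ((Π1), (Π2), (π), (κ); NO hypothesis on the fibre):
`(j_t^*)⁻¹ Nᵖ(X_t)` is spanned by its rational members (part XVII-b); the `e`-fixed companion `e W` of a rational member `W` is rational,
restricts to the algebraic — hence `(p,p)` — class `j_t^* W`, so is of type `(p,p)` (§3), hence algebraic; and `W − e W` dies on `X_t`.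
The analogue of part XXIV-d's `comap_le_sup_of_forall_topWeight_hodge_mem`. [cite: Milne2020HodgeClassesAV, proof of Prop. 1 (pp. 7–8)]
[cite: GrothendieckTopology1969, §1 p. 299] [cite: VoisinHodgeI2002, §7.1.1 and §11.3] -/
theorem comap_le_sup_of_forall_fixed_hodge_mem (hf : IsCompactAbelianPencil f d) (t : ComplexPoints S) {p : ℕ}
    (e : complexBetti 𝒳 (2 * p) →ₗ[ℂ] complexBetti 𝒳 (2 * p)) (halg : IsAlgebraicCorrespondence (d + 1) (d + 1) 𝒳 𝒳 e)
    (hQ : ∀ w, IsRationalClass w → IsRationalClass (e w))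
    (hπ : ∀ w, complexBetti.map (fiberι f t) (2 * p) (e w) = complexBetti.map (fiberι f t) (2 * p) w)
    (hκ : ∀ w, complexBetti.map (fiberι f t) (2 * p) w = 0 → e w = 0)
    (h : ∀ y₀ : complexBetti 𝒳 (2 * p), e y₀ = y₀ → IsRationalClass y₀ → IsOfHodgeType (d + 1) 𝒳 (2 * p) p p y₀ →
      y₀ ∈ algebraicClasses 𝒳 p) :
    (algebraicClasses (fiberOver f t) p).comap (complexBetti.map (fiberι f t) (2 * p)).hom ≤
      algebraicClasses 𝒳 p ⊔ LinearMap.ker (complexBetti.map (fiberι f t) (2 * p)).hom := by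
  have hXt := hf.isSmoothProjective_fiberOver t
  intro W hW
  have hW' : complexBetti.map (fiberι f t) (2 * p) W ∈ algebraicClasses (fiberOver f t) p := hW
  refine (Submodule.span_le (p := algebraicClasses 𝒳 p ⊔ LinearMap.ker (complexBetti.map (fiberι f t) (2 * p)).hom)).2
    ?_ (mem_span_rational_of_map_fiberι_mem_algebraicClasses hf hW')
  rintro W' ⟨hW'Q, hW'alg⟩
  obtain ⟨W₀, hW₀Q, hW₀e, hW₀j⟩ := exists_fixed_lift_rational t e hQ hπ hκ hW'Q
  have hH : IsOfHodgeType (d + 1) 𝒳 (2 * p) p p W₀ :=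
    isOfHodgeType_of_fixed hf t e halg hκ (by omega) hW₀e
      (by rw [hW₀j]; exact isOfHodgeType_of_mem_algebraicClasses_of_isSmoothProjective hXt p hW'alg)
  have hW₀alg : W₀ ∈ algebraicClasses 𝒳 p := h W₀ hW₀e hW₀Q hH
  change W' ∈ algebraicClasses 𝒳 p ⊔ LinearMap.ker (complexBetti.map (fiberι f t) (2 * p)).hom
  rw [show W' = W₀ + (W' - W₀) by abel]
  refine Submodule.add_mem_sup hW₀alg ?_
  rw [LinearMap.mem_ker, map_sub, sub_eq_zero]
  exact hW₀j.symm

/-- **(L)_t(p) ⟹ [every `e`-fixed rational `(p,p)`-class of `𝒳` is algebraic], at a fibre whose rational `(p,p)`-classes are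
algebraic** (an `E`-power fibre; a CM fibre under `HC_CM`): the restriction of such a class is a rational `(p,p)`-class of `X_t`, hence
algebraic, and the previous equivalence applies ((Π1), (π), (κ); no (Π2)). [cite: Milne2020HodgeClassesAV, proof of Prop. 1 (pp. 7–8)]
[cite: VoisinHodgeI2002, §7.1.1 and §11.3] -/
theorem fixed_hodge_mem_of_comap_le_sup (hf : IsCompactAbelianPencil f d) (t : ComplexPoints S) {p : ℕ}
    (e : complexBetti 𝒳 (2 * p) →ₗ[ℂ] complexBetti 𝒳 (2 * p)) (halg : IsAlgebraicCorrespondence (d + 1) (d + 1) 𝒳 𝒳 e)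
    (hπ : ∀ w, complexBetti.map (fiberι f t) (2 * p) (e w) = complexBetti.map (fiberι f t) (2 * p) w)
    (hκ : ∀ w, complexBetti.map (fiberι f t) (2 * p) w = 0 → e w = 0)
    (hfib : ∀ c : complexBetti (fiberOver f t) (2 * p), IsRationalClass c →
      IsOfHodgeType d (fiberOver f t) (2 * p) p p c → c ∈ algebraicClasses (fiberOver f t) p)
    (hL : (algebraicClasses (fiberOver f t) p).comap (complexBetti.map (fiberι f t) (2 * p)).hom ≤
      algebraicClasses 𝒳 p ⊔ LinearMap.ker (complexBetti.map (fiberι f t) (2 * p)).hom) :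
    ∀ y₀ : complexBetti 𝒳 (2 * p), e y₀ = y₀ → IsRationalClass y₀ → IsOfHodgeType (d + 1) 𝒳 (2 * p) p p y₀ →
      y₀ ∈ algebraicClasses 𝒳 p := by
  intro y₀ hy₀ hQ hH
  refine (comap_le_sup_iff_forall_fixed_mem hf t e halg hπ hκ).1 hL y₀ hy₀ (hfib _ ?_ ?_)
  · exact hQ.map (AlgPoints.mapContinuous (L := ℂ) (fiberι f t))
  · exact hH.map_of_isSmoothProjective (hf.isSmoothProjective_fiberOver t) hf.isSmoothProjective_total (fiberι f t)

/-- **(L)_t(p) ⟺ THE HODGE CONJECTURE FOR `Im e ⊂ H^{2p}(𝒳)`** (the rational `(p,p)`-classes fixed by `e` are algebraic), at a fibre whose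
rational `(p,p)`-classes are algebraic and for an algebraic Leray idempotent `e` with (Π1), (Π2), (π), (κ). `Im e` is a sub-Hodge
structure defined over `ℚ`, a complement of `ker j_t^*`, read isomorphically on the fibre (§2–§3); in print `H⁰(S, R^{2p} f_*ℚ)`.
[cite: Milne2020HodgeClassesAV, proof of Prop. 1 (pp. 7–8)] [cite: DeningerMurre1991, Thm. 3.1] [cite: VoisinHodgeI2002, §11.3 Conj. 11.24] -/
theorem comap_le_sup_iff_forall_fixed_hodge_mem (hf : IsCompactAbelianPencil f d) (t : ComplexPoints S) {p : ℕ}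
    (e : complexBetti 𝒳 (2 * p) →ₗ[ℂ] complexBetti 𝒳 (2 * p)) (halg : IsAlgebraicCorrespondence (d + 1) (d + 1) 𝒳 𝒳 e)
    (hQ : ∀ w, IsRationalClass w → IsRationalClass (e w))
    (hπ : ∀ w, complexBetti.map (fiberι f t) (2 * p) (e w) = complexBetti.map (fiberι f t) (2 * p) w)
    (hκ : ∀ w, complexBetti.map (fiberι f t) (2 * p) w = 0 → e w = 0)
    (hfib : ∀ c : complexBetti (fiberOver f t) (2 * p), IsRationalClass c →
      IsOfHodgeType d (fiberOver f t) (2 * p) p p c → c ∈ algebraicClasses (fiberOver f t) p) :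
    (algebraicClasses (fiberOver f t) p).comap (complexBetti.map (fiberι f t) (2 * p)).hom ≤
        algebraicClasses 𝒳 p ⊔ LinearMap.ker (complexBetti.map (fiberι f t) (2 * p)).hom ↔
      ∀ y₀ : complexBetti 𝒳 (2 * p), e y₀ = y₀ → IsRationalClass y₀ → IsOfHodgeType (d + 1) 𝒳 (2 * p) p p y₀ →
        y₀ ∈ algebraicClasses 𝒳 p :=
  ⟨fixed_hodge_mem_of_comap_le_sup hf t e halg hπ hκ hfib, comap_le_sup_of_forall_fixed_hodge_mem hf t e halg hQ hπ hκ⟩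

/-- **THE READING DOES NOT DEPEND ON THE IDEMPOTENT.** For two algebraic Leray idempotents `e, e'` at `t` in degree `2p` (both with
(Π1), (Π2), (π), (κ)): [the rational `(p,p)`-classes fixed by `e` are algebraic] ⟹ [the same for `e'`] — a rational `(p,p)`-class `y`
fixed by `e'` has the `e`-fixed companion `e y` (rational, of type `(p,p)`, algebraic by hypothesis), and `y = e' y = e'(e y) + e'(y − e y)`
with `y − e y ∈ ker j_t^* = ker e'`; `e'` preserves algebraic classes. No Hodge-conjecture input, no fibre hypothesis.
[cite: DeningerMurre1991, Thm. 3.1 and Cor. 3.2] [cite: VoisinHodgeII2003, §9.2.4 Prop. 9.21] -/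
theorem forall_fixed_hodge_mem_of_two (hf : IsCompactAbelianPencil f d) (t : ComplexPoints S) {p : ℕ}
    (e e' : complexBetti 𝒳 (2 * p) →ₗ[ℂ] complexBetti 𝒳 (2 * p)) (halg : IsAlgebraicCorrespondence (d + 1) (d + 1) 𝒳 𝒳 e)
    (hQ : ∀ w, IsRationalClass w → IsRationalClass (e w))
    (hπ : ∀ w, complexBetti.map (fiberι f t) (2 * p) (e w) = complexBetti.map (fiberι f t) (2 * p) w)
    (hκ : ∀ w, complexBetti.map (fiberι f t) (2 * p) w = 0 → e w = 0)
    (halg' : IsAlgebraicCorrespondence (d + 1) (d + 1) 𝒳 𝒳 e')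
    (hκ' : ∀ w, complexBetti.map (fiberι f t) (2 * p) w = 0 → e' w = 0)
    (h : ∀ y₀ : complexBetti 𝒳 (2 * p), e y₀ = y₀ → IsRationalClass y₀ → IsOfHodgeType (d + 1) 𝒳 (2 * p) p p y₀ →
      y₀ ∈ algebraicClasses 𝒳 p) :
    ∀ y₀ : complexBetti 𝒳 (2 * p), e' y₀ = y₀ → IsRationalClass y₀ → IsOfHodgeType (d + 1) 𝒳 (2 * p) p p y₀ →
      y₀ ∈ algebraicClasses 𝒳 p := by
  have h𝒳 := hf.isSmoothProjective_total
  intro y hy hyQ hyH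
  have he : e y ∈ algebraicClasses 𝒳 p :=
    h (e y) (leray_idempotent t e hπ hκ y) (hQ y hyQ) (IsAlgebraicCorrespondence.isOfHodgeType_endo h𝒳 halg hyH)
  have hdiff : e' (y - e y) = 0 := hκ' _ (by rw [map_sub, hπ, sub_self])
  have hy' : y = e' (e y) := by
    conv_lhs => rw [← hy, show y = e y + (y - e y) by abel, map_add, hdiff, add_zero]
  rw [hy']
  exact map_mem_algebraicClasses_of_isAlgebraicCorrespondence h𝒳 h𝒳 halg' he

/-- **Symmetric form**: for two algebraic Leray idempotents at `(t, 2p)` with (Π1), (Π2), (π), (κ) the two Hodge readings are EQUIVALENT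
(the `B_min` candidate "HC for `Im e`" is independent of the choice of `e`). [cite: DeningerMurre1991, Thm. 3.1 and Cor. 3.2] -/
theorem forall_fixed_hodge_mem_iff_of_two (hf : IsCompactAbelianPencil f d) (t : ComplexPoints S) {p : ℕ}
    (e e' : complexBetti 𝒳 (2 * p) →ₗ[ℂ] complexBetti 𝒳 (2 * p)) (halg : IsAlgebraicCorrespondence (d + 1) (d + 1) 𝒳 𝒳 e)
    (hQ : ∀ w, IsRationalClass w → IsRationalClass (e w))
    (hπ : ∀ w, complexBetti.map (fiberι f t) (2 * p) (e w) = complexBetti.map (fiberι f t) (2 * p) w)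
    (hκ : ∀ w, complexBetti.map (fiberι f t) (2 * p) w = 0 → e w = 0)
    (halg' : IsAlgebraicCorrespondence (d + 1) (d + 1) 𝒳 𝒳 e') (hQ' : ∀ w, IsRationalClass w → IsRationalClass (e' w))
    (hπ' : ∀ w, complexBetti.map (fiberι f t) (2 * p) (e' w) = complexBetti.map (fiberι f t) (2 * p) w)
    (hκ' : ∀ w, complexBetti.map (fiberι f t) (2 * p) w = 0 → e' w = 0) :
    (∀ y₀ : complexBetti 𝒳 (2 * p), e y₀ = y₀ → IsRationalClass y₀ → IsOfHodgeType (d + 1) 𝒳 (2 * p) p p y₀ →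
        y₀ ∈ algebraicClasses 𝒳 p) ↔
      ∀ y₀ : complexBetti 𝒳 (2 * p), e' y₀ = y₀ → IsRationalClass y₀ → IsOfHodgeType (d + 1) 𝒳 (2 * p) p p y₀ →
        y₀ ∈ algebraicClasses 𝒳 p :=
  ⟨forall_fixed_hodge_mem_of_two hf t e e' halg hQ hπ hκ halg' hκ',
    forall_fixed_hodge_mem_of_two hf t e' e halg' hQ' hπ' hκ' halg hκ⟩

end Lift


end Summit.HodgeConjecture.HodgeConjecture.Ring2.AbelianAll

end
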